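import Mathlib
import HarnessLib

/-!
# Reproducing kernels of finite-dimensional spaces of continuous functions on a compact group
# evaluate `K₁`-averages

Abstract harmonic analysis on a compact space / compact group (theorems only: no definition, no
named fact).

Let `X` be a compact space with a Borel measure `μ` that is finite on compact sets and charges
every non-empty open set (e.g. a Haar measure on a compact group), and let `Pol` be a
finite-dimensional space of continuous functions `X → ℂ`.  The `L²(μ)` pairing
`⟪P, Q⟫ = ∫ conj P · Q dμ` is a positive-definite Hermitian form on `Pol` (a continuous `Q` with
`∫ ‖Q‖² dμ = 0` vanishes identically because `μ` is positive on opens), so `Pol` is a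
finite-dimensional Hilbert space and every linear functional `ℓ` on `Pol` has a Riesz representer
`Z ∈ Pol`, `∫ conj Z · Q dμ = ℓ(Q)` (`exists_mem_integral_conj_mul_eq_linearMap`; with an
orthonormal basis `b`, `Z = ∑ conj (ℓ bᵢ) • bᵢ`).  In particular `Pol` has a REPRODUCING KERNEL at
every point `g`, `∫ conj Z_g · Q dμ = Q(g)` (`exists_mem_integral_conj_mul_eq_apply`).

Main result (`exists_reproducingKernel_kOneAverage`): let `G` be a compact second-countable group
with Haar measure `μ`, `K₁ ≤ G` a closed subgroup with Haar measure `μ₁`, and `Pol` a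
finite-dimensional space of continuous LEFT-`K₁`-invariant functions.  Then some `Z ∈ Pol`
satisfies

  `∫_G conj Z(k) · φ(k) dμ(k) = ∫_{K₁} φ(k₁) dμ₁(k₁)`

for every continuous `φ : G → ℂ` whose left `K₁`-average `A φ : k ↦ ∫_{K₁} φ(k₁ k) dμ₁(k₁)` lies
in `Pol`.  Proof: with `Z₀` the reproducing kernel at `1`,
`∫_{K₁} φ = (A φ)(1) = ∫_G conj Z₀ · A φ dμ = ∫_{K₁} ∫_G conj Z₀(k) φ(k₁ k) dμ(k) dμ₁(k₁)` (Fubini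
on the compact group `G × K₁`), and each inner integral equals `∫_G conj Z₀ · φ dμ` by left
`K₁`-invariance of `Z₀` and left invariance of `μ`; so `Z = μ₁(K₁) · Z₀` works.

This is the device behind the choice of the weight polynomial in the archimedean test-vector
computations for `GL_n × GL_n` Rankin–Selberg integrals (the `K`-type polynomial reproducing a
`K₁`-average); it is isolated here as compact-group measure theory.

References: standard (finite-dimensional Riesz representation; A. Weil, *L'intégration dans les
groupes topologiques et ses applications* (1940), §§7–8, for Haar measure on compact groups).
What is NOT here: infinite-dimensional reproducing-kernel Hilbert spaces, the Peter–Weyl theorem,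
and any identification of `Pol` with matrix coefficients.
-/

open MeasureTheory MeasureTheory.Measure Filter Complex
open scoped ComplexConjugate InnerProductSpace

namespace Literature.RepresentationTheory.CompactGroups

noncomputable section

section Riesz

variable {X : Type*} [TopologicalSpace X] [CompactSpace X] [MeasurableSpace X]
  [OpensMeasurableSpace X]

/-- On a compact space, a continuous function is integrable for every measure finite on compact
sets. [folklore] -/
theorem integrable_of_continuous_of_compactSpace {E : Type*} [NormedAddCommGroup E]
    {μ : Measure X} [IsFiniteMeasureOnCompacts μ] {f : X → E} (hf : Continuous f) :
    Integrable f μ :=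
  hf.integrable_of_hasCompactSupport (HasCompactSupport.of_compactSpace f)

omit [TopologicalSpace X] [CompactSpace X] [OpensMeasurableSpace X] in
/-- `∫ conj f · f dμ = ∫ ‖f‖² dμ` (a real number, cast to `ℂ`). [folklore] -/
theorem integral_conj_mul_self (μ : Measure X) (f : X → ℂ) :
    ∫ x, conj (f x) * f x ∂μ = ((∫ x, ‖f x‖ ^ 2 ∂μ : ℝ) : ℂ) := by
  rw [← integral_complex_ofReal]
  refine integral_congr_ae (Eventually.of_forall fun x => ?_)
  simp only [conj_mul', Complex.ofReal_pow]

/-- A continuous function on a compact space whose `L²`-norm vanishes, for a measure charging every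
non-empty open set, is identically zero. [folklore] -/
theorem eq_zero_of_integral_norm_sq_eq_zero (μ : Measure X) [IsFiniteMeasureOnCompacts μ]
    [IsOpenPosMeasure μ] {f : X → ℂ} (hf : Continuous f) (h : ∫ x, ‖f x‖ ^ 2 ∂μ = 0) :
    f = 0 := by
  funext x
  by_contra hx
  have hpos : 0 < ∫ x, ‖f x‖ ^ 2 ∂μ :=
    Continuous.integral_pos_of_hasCompactSupport_nonneg_nonzero (x := x) (by fun_prop)
      (HasCompactSupport.of_compactSpace _) (fun y => by positivity)
      (pow_ne_zero 2 (norm_ne_zero_iff.2 hx))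
  exact hpos.ne' h

/-- **Riesz representers for the `L²(μ)` pairing on a finite-dimensional space of continuous
functions.**  For `X` compact, `μ` finite on compacts and positive on non-empty open sets, `Pol` a
finite-dimensional space of continuous functions `X → ℂ` and `ℓ` a linear functional on `Pol`,
there is `Z ∈ Pol` with `∫ conj Z · Q dμ = ℓ Q` for all `Q ∈ Pol`.  Proof:
`⟪P, Q⟫ = ∫ conj P · Q dμ` is a positive-definite inner product on `Pol`
(`eq_zero_of_integral_norm_sq_eq_zero`); for an
orthonormal basis `b` take `Z = ∑ᵢ conj (ℓ bᵢ) • bᵢ`. [folklore] -/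
theorem exists_mem_integral_conj_mul_eq_linearMap (μ : Measure X) [IsFiniteMeasureOnCompacts μ]
    [IsOpenPosMeasure μ] (Pol : Submodule ℂ (X → ℂ)) [FiniteDimensional ℂ Pol]
    (hcont : ∀ Q ∈ Pol, Continuous Q) (ℓ : Pol →ₗ[ℂ] ℂ) :
    ∃ Z ∈ Pol, ∀ (Q : X → ℂ) (hQ : Q ∈ Pol), ∫ x, conj (Z x) * Q x ∂μ = ℓ ⟨Q, hQ⟩ := by
  have hint : ∀ P Q : Pol, Integrable (fun x => conj ((P : X → ℂ) x) * (Q : X → ℂ) x) μ :=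
    fun P Q => integrable_of_continuous_of_compactSpace
      ((Complex.continuous_conj.comp (hcont _ P.2)).mul (hcont _ Q.2))
  obtain ⟨core, hcore⟩ : ∃ core : InnerProductSpace.Core ℂ Pol,
      ∀ P Q : Pol, core.inner P Q = ∫ x, conj ((P : X → ℂ) x) * (Q : X → ℂ) x ∂μ :=
    ⟨{ inner := fun P Q => ∫ x, conj ((P : X → ℂ) x) * (Q : X → ℂ) x ∂μ
       conj_inner_symm := fun P Q => by
         change conj (∫ x, conj ((Q : X → ℂ) x) * (P : X → ℂ) x ∂μ) =
           ∫ x, conj ((P : X → ℂ) x) * (Q : X → ℂ) x ∂μ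
         rw [← integral_conj]
         exact integral_congr_ae (Eventually.of_forall fun x => by simp [mul_comm])
       re_inner_nonneg := fun P => by
         change 0 ≤ (∫ x, conj ((P : X → ℂ) x) * (P : X → ℂ) x ∂μ).re
         rw [integral_conj_mul_self, Complex.ofReal_re]
         exact integral_nonneg fun x => by positivity
       add_left := fun P Q R => by
         change ∫ x, conj (((P + Q : Pol) : X → ℂ) x) * (R : X → ℂ) x ∂μ =
           (∫ x, conj ((P : X → ℂ) x) * (R : X → ℂ) x ∂μ) +
             ∫ x, conj ((Q : X → ℂ) x) * (R : X → ℂ) x ∂μ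
         rw [← integral_add (hint P R) (hint Q R)]
         exact integral_congr_ae (Eventually.of_forall fun x => by
           simp [Submodule.coe_add, add_mul])
       smul_left := fun P Q r => by
         change ∫ x, conj (((r • P : Pol) : X → ℂ) x) * (Q : X → ℂ) x ∂μ =
           conj r * ∫ x, conj ((P : X → ℂ) x) * (Q : X → ℂ) x ∂μ
         rw [← integral_const_mul]
         exact integral_congr_ae (Eventually.of_forall fun x => by
           simp [mul_assoc])
       definite := fun P hP => by
         have h0 : ∫ x, conj ((P : X → ℂ) x) * (P : X → ℂ) x ∂μ = 0 := hP
         rw [integral_conj_mul_self, Complex.ofReal_eq_zero] at h0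
         exact Subtype.ext (eq_zero_of_integral_norm_sq_eq_zero μ (hcont _ P.2) h0) },
     fun _ _ => rfl⟩
  letI i1 : NormedAddCommGroup Pol :=
    @InnerProductSpace.Core.toNormedAddCommGroup ℂ Pol _ _ _ core
  letI i2 : InnerProductSpace ℂ Pol := InnerProductSpace.ofCore core.toCore
  have hinner : ∀ P Q : Pol, ⟪P, Q⟫_ℂ = ∫ x, conj ((P : X → ℂ) x) * (Q : X → ℂ) x ∂μ := hcore
  let b := stdOrthonormalBasis ℂ Pol
  let W : Pol := ∑ i, conj (ℓ (b i)) • b i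
  refine ⟨(W : X → ℂ), W.2, fun Q hQ => ?_⟩
  have key : ⟪W, (⟨Q, hQ⟩ : Pol)⟫_ℂ = ∫ x, conj ((W : X → ℂ) x) * Q x ∂μ := hinner W ⟨Q, hQ⟩
  rw [← key, sum_inner]
  simp_rw [inner_smul_left, starRingEnd_self_apply]
  conv_rhs => rw [← b.sum_repr' ⟨Q, hQ⟩, _root_.map_sum]
  simp_rw [map_smul, smul_eq_mul]
  exact Finset.sum_congr rfl fun i _ => mul_comm _ _

/-- **Reproducing kernel at a point.**  For `X` compact, `μ` finite on compacts and positive on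
non-empty open sets and `Pol` a finite-dimensional space of continuous functions `X → ℂ`, every
point `g` has a reproducing kernel `Z ∈ Pol`: `∫ conj Z · Q dμ = Q g` for all `Q ∈ Pol`
(`exists_mem_integral_conj_mul_eq_linearMap` for the evaluation functional). [folklore] -/
theorem exists_mem_integral_conj_mul_eq_apply (μ : Measure X) [IsFiniteMeasureOnCompacts μ]
    [IsOpenPosMeasure μ] (Pol : Submodule ℂ (X → ℂ)) [FiniteDimensional ℂ Pol]
    (hcont : ∀ Q ∈ Pol, Continuous Q) (g : X) :
    ∃ Z ∈ Pol, ∀ Q ∈ Pol, ∫ x, conj (Z x) * Q x ∂μ = Q g := by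
  obtain ⟨Z, hZ, h⟩ := exists_mem_integral_conj_mul_eq_linearMap μ Pol hcont
    ((LinearMap.proj (R := ℂ) (φ := fun _ : X => ℂ) g).comp Pol.subtype)
  exact ⟨Z, hZ, fun Q hQ => by simpa using h Q hQ⟩

end Riesz

section KOneAverage

variable {G : Type*} [Group G] [TopologicalSpace G] [IsTopologicalGroup G] [CompactSpace G]
  [MeasurableSpace G] [BorelSpace G]

/-- **The reproducing kernel of a finite-dimensional space of left-`K₁`-invariant continuous
functions on a compact group evaluates `K₁`-averages.**  Let `G` be a compact second-countable
group with Haar measure `μ`, `K₁ ≤ G` a closed subgroup with Haar measure `μ₁`, and `Pol` a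
finite-dimensional space of continuous functions `G → ℂ` that are left-`K₁`-invariant
(`Q (k₁ k) = Q k`).  Then there is `Z ∈ Pol` such that
`∫_G conj Z · φ dμ = ∫_{K₁} φ dμ₁` for every continuous `φ : G → ℂ` whose left `K₁`-average
`k ↦ ∫_{K₁} φ (k₁ k) dμ₁(k₁)` lies in `Pol`.  Proof: `Z = μ₁(K₁) · Z₀` with `Z₀` the reproducing
kernel at `1` (`exists_mem_integral_conj_mul_eq_apply`): `∫_{K₁} φ = (average)(1) =
∫_G conj Z₀ · (average) dμ`, then Fubini on the compact group `G × K₁` and, for each `k₁`,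
`∫_G conj Z₀(k) φ(k₁ k) dμ(k) = ∫_G conj Z₀(k₁ k) φ(k₁ k) dμ(k) = ∫_G conj Z₀ · φ dμ` by the
`K₁`-invariance of `Z₀` and the left invariance of `μ`. [folklore] -/
theorem exists_reproducingKernel_kOneAverage [SecondCountableTopology G]
    (μ : Measure G) [IsHaarMeasure μ] (K₁ : Subgroup G) (hK₁ : IsClosed (K₁ : Set G))
    (μ₁ : Measure K₁) [IsHaarMeasure μ₁]
    (Pol : Submodule ℂ (G → ℂ)) [FiniteDimensional ℂ Pol]
    (hcont : ∀ Q ∈ Pol, Continuous Q) (hleft : ∀ Q ∈ Pol, ∀ k₁ ∈ K₁, ∀ k : G, Q (k₁ * k) = Q k) :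
    ∃ Z ∈ Pol, ∀ φ : G → ℂ, Continuous φ → (fun k => ∫ k₁ : K₁, φ ((k₁ : G) * k) ∂μ₁) ∈ Pol →
      ∫ k, conj (Z k) * φ k ∂μ = ∫ k₁ : K₁, φ (k₁ : G) ∂μ₁ := by
  haveI : CompactSpace K₁ := isCompact_iff_compactSpace.mp hK₁.isCompact
  -- the reproducing kernel at `1`
  obtain ⟨Z₀, hZ₀, hrep⟩ := exists_mem_integral_conj_mul_eq_apply μ Pol hcont (1 : G)
  have hZc : Continuous Z₀ := hcont _ hZ₀
  refine ⟨((μ₁.real Set.univ : ℝ) : ℂ) • Z₀, Pol.smul_mem _ hZ₀, fun φ hφ hA => ?_⟩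
  -- Step 1: the average at `1` is `∫_{K₁} φ`, and the kernel computes it.
  have h1 : ∫ k, conj (Z₀ k) * (∫ k₁ : K₁, φ ((k₁ : G) * k) ∂μ₁) ∂μ =
      ∫ k₁ : K₁, φ (k₁ : G) ∂μ₁ := by
    simpa using hrep _ hA
  -- Step 2: Fubini on `G × K₁`.
  have hF : Integrable (Function.uncurry fun (k : G) (k₁ : K₁) => conj (Z₀ k) * φ ((k₁ : G) * k))
      (μ.prod μ₁) :=
    integrable_of_continuous_of_compactSpace
      ((Complex.continuous_conj.comp (hZc.comp continuous_fst)).mul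
        (hφ.comp ((continuous_subtype_val.comp continuous_snd).mul continuous_fst)))
  have h2 : ∫ k, conj (Z₀ k) * (∫ k₁ : K₁, φ ((k₁ : G) * k) ∂μ₁) ∂μ =
      ∫ k₁ : K₁, ∫ k, conj (Z₀ k) * φ ((k₁ : G) * k) ∂μ ∂μ₁ := by
    rw [← integral_integral_swap hF]
    exact integral_congr_ae (Eventually.of_forall fun k => (integral_const_mul _ _).symm)
  -- Step 3: each inner integral is `∫ conj Z₀ · φ dμ` (invariance of `Z₀` and of `μ`).
  have h3 : ∀ k₁ : K₁, ∫ k, conj (Z₀ k) * φ ((k₁ : G) * k) ∂μ = ∫ k, conj (Z₀ k) * φ k ∂μ := by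
    intro k₁
    calc ∫ k, conj (Z₀ k) * φ ((k₁ : G) * k) ∂μ
        = ∫ k, (fun x => conj (Z₀ x) * φ x) ((k₁ : G) * k) ∂μ :=
          integral_congr_ae (Eventually.of_forall fun k => by
            simp only [hleft _ hZ₀ _ k₁.2 k])
      _ = ∫ k, conj (Z₀ k) * φ k ∂μ :=
          integral_mul_left_eq_self (fun x => conj (Z₀ x) * φ x) (k₁ : G)
  -- Assemble.
  calc ∫ k, conj ((((μ₁.real Set.univ : ℝ) : ℂ) • Z₀) k) * φ k ∂μ
      = ((μ₁.real Set.univ : ℝ) : ℂ) * ∫ k, conj (Z₀ k) * φ k ∂μ := by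
        rw [← integral_const_mul]
        exact integral_congr_ae (Eventually.of_forall fun k => by
          simp [Pi.smul_apply, smul_eq_mul, mul_assoc])
    _ = ∫ _k₁ : K₁, (∫ k, conj (Z₀ k) * φ k ∂μ) ∂μ₁ := by
        rw [integral_const, Complex.real_smul]
    _ = ∫ k₁ : K₁, ∫ k, conj (Z₀ k) * φ ((k₁ : G) * k) ∂μ ∂μ₁ :=
        integral_congr_ae (Eventually.of_forall fun k₁ => (h3 k₁).symm)
    _ = ∫ k, conj (Z₀ k) * (∫ k₁ : K₁, φ ((k₁ : G) * k) ∂μ₁) ∂μ := h2.symm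
    _ = ∫ k₁ : K₁, φ (k₁ : G) ∂μ₁ := h1

end KOneAverage

end

end Literature.RepresentationTheory.CompactGroups
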